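/-
Copyright (c) 2026 the pub-hodgecm-mathlib formalisation cell (harness21).  Prover seat hodgecm-mathlib-K2Liu-p08 (g0), Track B «K2-LIT»,
#184♮ = hLiu418 = `stmt-HodgeConjecture-24832`; LEAD F0P6-plan (g11) DEALS-req649 (S2′) 2026-09-04T05:28:07Z «#33b (a) (B) FINITE-PLACE
MAIN-ORBIT OPEN EMBEDDING» (name of record), box 05:32:24Z «GO AS REPORTED»; after K2E5-p17 (g3)'s heir memo `CENSUS-33b-a-B`
c0f3422280440fab; inputs (A) ★ p857583, (A′) ★ p857600, (B-i) `K2LiuSiegelMainOrbitDecompositionLoc`.  File (B-ii) of two: the TOPOLOGY.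
-/
import Summits.HodgeConjecture.HodgeConjecture.Theorems.K2LiuSiegelMainOrbitDecompositionLoc   -- (B-i): §0 Pi-inverse, §1–§2 decomposition
import Mathlib.Topology.Algebra.Group.Pointwise
import HarnessLib

/-!
# Crux `HLiu418`, road `K2_Liu`, socket #33b organ (a), file (B-ii): the doubling MAIN ORBIT `Ω_v ⊆ H_v` is OPEN and
# `P_{Δ,v} × G_v → H_v`, `(p, x) ↦ p · ι_v(x, 1)` is an OPEN EMBEDDING onto it; (D1) `P_{Δ,v} · ι_v(C, 1)` is closed for compact `C`

Cell `hodgecm-mathlib`, crux item hLiu418 = `stmt-HodgeConjecture-24832`; LEAD F0P6-plan (g11), box K2E5-r01 (g6), consumer K2E2-p12 (g3)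
(#33b `sig_K2LiuSiegelBigCellSection`, organ (D) + assembly; RULING «M-155n» (3)(5)).  THEOREMS ONLY (no `def`, no instance, no notation,
no named-fact hypothesis, no `sorry`); lane `--supports stmt-HodgeConjecture-24832 --as helper` (count-neutral).  The socket∕file NAME says
«big cell» (frozen, PSR's loose usage); the set is the doubling MAIN ORBIT `Ω_v = P_{Δ,v} · ι_v(G_v × 1) = {h ∈ H_v | IsUnit M(h)}`
(RULING «M-155n» (1); ★ (A)∕(A′)).  Setting, symbols `H_v, G_v, ι_v, B(h), M(h), A°(h), 𝕁_v, c` and the algebra: file (B-i)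
`K2LiuSiegelMainOrbitDecompositionLoc` (every symbol is SPELLED OUT in the statements; the matrix of an element is `Units.val (Subtype.val h)`).
The archimedean twin (C) is K2Liu-p10 (g0)'s `K2LiuSiegelMainOrbitOpenEmbeddingArch` over the generic `K2LiuSiegelMainOrbitOpenEmbeddingGeneric`.

* §3 topology: `h ↦ B(h)`, `M(h)`, `B(h)₁₁ − B(h)₂₁` are continuous; **`Ω_v = {IsUnit M(h)}` is OPEN** (`isOpen_setOf_isUnit_mainOrbitBlock`:
  `IsUnit (det M(h))` is `∀ w ∣ v, det M(h)_w ≠ 0`); `(p, x) ↦ p · ι_v(x, 1)` is continuous; `h ↦ M(h)⁻¹` and `h ↦ A°(h)` are continuous ON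
  `Ω_v` ((B-i) §0 + Mathlib `continuousAt_matrix_inv`); the inverse `h ↦ (h · ι_v(x(h), 1)⁻¹, x(h))` (`x(h) ∈ G_v` the element with matrix
  `A°(h)`, `x(h)⁻¹` via `A°⁻¹ = 𝕁_v⁻¹ ᵗ(c A°) 𝕁_v`, `Units.continuous_iff`) is continuous on the `Ω_v`-subtype, so the map is an OPEN MAP
  (`isOpenMap_siegel_mul_iotaGGLoc`) and **an OPEN EMBEDDING** (`isOpenEmbedding_siegel_mul_iotaGGLoc`) **with RANGE `Ω_v`**
  (`range_siegel_mul_iotaGGLoc`, `exists_siegel_mul_iotaGGLoc_eq`).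
* §4 (D1) `P_{Δ,v} = {IsSiegelM}` is closed; for compact `C ⊆ G_v` the set `P_{Δ,v} · ι_v(C, 1)` is CLOSED in `H_v`
  (`isClosed_image_siegel_mul_iotaGGLoc_of_isCompact`; `IsClosed.mul_right_of_isCompact`, needs neither `hJ` nor §3).

Hypothesis `hJ : IsUnit (det 𝕁_v)` (true for `dV i ≠ 0`, `dW j ≠ 0`; discharged by the consumer or a one-line lemma).
[GelbartPiatetskishapiroRallis1987, Part A §1–§2 (the main `G × G`-orbit on `P \ H` is open)] [Liu2021, §B.3 (B.5), Lem. B.11]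
[HarrisKudlaSweet1996, §1 (1.11)] [Liu2011, §2C p. 863].
HONEST LABEL.  Count-neutral helper; `HC_CM` is proved only modulo the 7 printed citations (2 remaining named inputs: hLiu418 =
`stmt-HodgeConjecture-24832`, h413 = `stmt-HodgeConjecture-24833`) until rung 0 closes.
-/

set_option autoImplicit false
set_option linter.dupNamespace false -- the mandated namespace repeats `HodgeConjecture.HodgeConjecture`

noncomputable section

namespace Summit.HodgeConjecture.HodgeConjecture.Cruxes.HLiu418.K2LiuSiegelBigCellOpenEmbedding

open scoped Matrix Pointwise
open Topology Filter
open NumberField IsDedekindDomain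
open Literature.NumberTheory.Automorphic
open Literature.NumberTheory.GelbartRogawski1991 Literature.NumberTheory.GelbartRogawski1991.GRConstruction
open Literature.NumberTheory.K2Lit.SiegelDoubled
open Summit.HodgeConjecture.HodgeConjecture.Cruxes.HLiu418.K2LiuDoublingMainOrbitBlocksUnit
open Summit.HodgeConjecture.HodgeConjecture.Cruxes.HLiu418.K2LiuDoublingMainOrbitBlocksRing
open Summit.HodgeConjecture.HodgeConjecture.Cruxes.HLiu418.K2LiuSiegelMainOrbitDecompositionLoc

section Local

variable (L : Type) [Field L] [NumberField L] [IsCMField L]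
variable {N M n : ℕ} (e : Fin N × Fin M ≃ Fin n)
  (dV : Fin N → L) (hdV : ∀ i, IsCMField.complexConj L (dV i) = dV i)
  (dW : Fin M → L) (hdW : ∀ i, IsCMField.complexConj L (dW i) = dW i)
  (v : HeightOneSpectrum (𝓞 (Fp L)))

/-! ## §3 Topology: `Ω_v` is open and `(p, x) ↦ p · ι_v(x, 1)` is an open embedding onto it -/

/-- `h ↦ B(h)` is continuous on `H_v`. [folklore] -/
theorem continuous_reindex_coe :
    Continuous fun h : UnitaryGroup.«local» L (IsCMField.complexConj L) (n + n) (hermD L e dV hdV dW hdW) v =>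
      Matrix.reindex (e₂ (n := n)).symm (e₂ (n := n)).symm (Units.val (Subtype.val h)) :=
  (Units.continuous_val.comp continuous_subtype_val).matrix_submatrix _ _

/-- `h ↦ M(h) = B(h)₂₂ − B(h)₁₂` is continuous on `H_v`. [folklore] -/
theorem continuous_mainOrbitBlock :
    Continuous fun h : UnitaryGroup.«local» L (IsCMField.complexConj L) (n + n) (hermD L e dV hdV dW hdW) v =>
      (Matrix.reindex (e₂ (n := n)).symm (e₂ (n := n)).symm (Units.val (Subtype.val h))).toBlocks₂₂ -
        (Matrix.reindex (e₂ (n := n)).symm (e₂ (n := n)).symm (Units.val (Subtype.val h))).toBlocks₁₂ :=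
  ((continuous_reindex_coe L e dV hdV dW hdW v).matrix_submatrix Sum.inr Sum.inr).sub
    ((continuous_reindex_coe L e dV hdV dW hdW v).matrix_submatrix Sum.inl Sum.inr)

/-- `h ↦ B(h)₁₁ − B(h)₂₁` is continuous on `H_v`. [folklore] -/
theorem continuous_subBlock :
    Continuous fun h : UnitaryGroup.«local» L (IsCMField.complexConj L) (n + n) (hermD L e dV hdV dW hdW) v =>
      (Matrix.reindex (e₂ (n := n)).symm (e₂ (n := n)).symm (Units.val (Subtype.val h))).toBlocks₁₁ -
        (Matrix.reindex (e₂ (n := n)).symm (e₂ (n := n)).symm (Units.val (Subtype.val h))).toBlocks₂₁ :=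
  ((continuous_reindex_coe L e dV hdV dW hdW v).matrix_submatrix Sum.inl Sum.inl).sub
    ((continuous_reindex_coe L e dV hdV dW hdW v).matrix_submatrix Sum.inr Sum.inl)

/-- **`Ω_v = {h ∈ H_v | IsUnit M(h)}` is OPEN** (`IsUnit (det M(h))` is `∀ w ∣ v, det M(h)_w ≠ 0`, finitely many open conditions).
[cite: GelbartPiatetskishapiroRallis1987, Part A §1–§2] -/
theorem isOpen_setOf_isUnit_mainOrbitBlock :
    IsOpen {h : UnitaryGroup.«local» L (IsCMField.complexConj L) (n + n) (hermD L e dV hdV dW hdW) v |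
      IsUnit ((Matrix.reindex (e₂ (n := n)).symm (e₂ (n := n)).symm (Units.val (Subtype.val h))).toBlocks₂₂ -
        (Matrix.reindex (e₂ (n := n)).symm (e₂ (n := n)).symm (Units.val (Subtype.val h))).toBlocks₁₂)} := by
  have hset : {h : UnitaryGroup.«local» L (IsCMField.complexConj L) (n + n) (hermD L e dV hdV dW hdW) v |
      IsUnit ((Matrix.reindex (e₂ (n := n)).symm (e₂ (n := n)).symm (Units.val (Subtype.val h))).toBlocks₂₂ -
        (Matrix.reindex (e₂ (n := n)).symm (e₂ (n := n)).symm (Units.val (Subtype.val h))).toBlocks₁₂)} =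
      (fun h : UnitaryGroup.«local» L (IsCMField.complexConj L) (n + n) (hermD L e dV hdV dW hdW) v =>
        ((Matrix.reindex (e₂ (n := n)).symm (e₂ (n := n)).symm (Units.val (Subtype.val h))).toBlocks₂₂ -
          (Matrix.reindex (e₂ (n := n)).symm (e₂ (n := n)).symm (Units.val (Subtype.val h))).toBlocks₁₂).det) ⁻¹'
        {y : UnitaryGroup.LocalRing L v | IsUnit y} := by
    ext h
    simp only [Set.mem_setOf_eq, Set.mem_preimage, Matrix.isUnit_iff_isUnit_det]
  rw [hset]
  exact isOpen_setOf_isUnit_pi.preimage (continuous_mainOrbitBlock L e dV hdV dW hdW v).matrix_det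

/-- **`(p, x) ↦ p · ι_v(x, 1)` is continuous.** [folklore] -/
theorem continuous_siegel_mul_iotaGGLoc :
    Continuous (fun px :
        {p : UnitaryGroup.«local» L (IsCMField.complexConj L) (n + n) (hermD L e dV hdV dW hdW) v //
            IsSiegelM (n := n) (Units.val (Subtype.val p))} × localPairU L dV dW v =>
      (px.1.1 : UnitaryGroup.«local» L (IsCMField.complexConj L) (n + n) (hermD L e dV hdV dW hdW) v) *
        iotaGGLoc L e dV hdV dW hdW v (px.2, 1)) :=
  (continuous_subtype_val.comp continuous_fst).mul
    ((continuous_iotaGGLoc L e dV hdV dW hdW v).comp (continuous_snd.prodMk continuous_const))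

/-- **`h ↦ M(h)⁻¹` is continuous on `Ω_v`** (§0 at `det M(h)` + Mathlib `continuousAt_matrix_inv`). [folklore] -/
theorem continuousOn_inv_mainOrbitBlock :
    ContinuousOn (fun h : UnitaryGroup.«local» L (IsCMField.complexConj L) (n + n) (hermD L e dV hdV dW hdW) v =>
        ((Matrix.reindex (e₂ (n := n)).symm (e₂ (n := n)).symm (Units.val (Subtype.val h))).toBlocks₂₂ -
          (Matrix.reindex (e₂ (n := n)).symm (e₂ (n := n)).symm (Units.val (Subtype.val h))).toBlocks₁₂)⁻¹)
      {h | IsUnit ((Matrix.reindex (e₂ (n := n)).symm (e₂ (n := n)).symm (Units.val (Subtype.val h))).toBlocks₂₂ -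
        (Matrix.reindex (e₂ (n := n)).symm (e₂ (n := n)).symm (Units.val (Subtype.val h))).toBlocks₁₂)} := by
  intro h hh
  refine ContinuousAt.continuousWithinAt ?_
  have hdet : IsUnit ((Matrix.reindex (e₂ (n := n)).symm (e₂ (n := n)).symm (Units.val (Subtype.val h))).toBlocks₂₂ -
      (Matrix.reindex (e₂ (n := n)).symm (e₂ (n := n)).symm (Units.val (Subtype.val h))).toBlocks₁₂).det :=
    (Matrix.isUnit_iff_isUnit_det _).1 hh
  have h1 : ContinuousAt (fun h' : UnitaryGroup.«local» L (IsCMField.complexConj L) (n + n) (hermD L e dV hdV dW hdW) v =>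
      (Matrix.reindex (e₂ (n := n)).symm (e₂ (n := n)).symm (Units.val (Subtype.val h'))).toBlocks₂₂ -
        (Matrix.reindex (e₂ (n := n)).symm (e₂ (n := n)).symm (Units.val (Subtype.val h'))).toBlocks₁₂) h :=
    (continuous_mainOrbitBlock L e dV hdV dW hdW v).continuousAt
  have h2 := continuousAt_matrix_inv _ (continuousAt_ringInverse_pi hdet)
  exact h2.comp_of_eq h1 rfl

/-- **`h ↦ A°(h)` is continuous on `Ω_v`.** [folklore] -/
theorem continuousOn_mainOrbitInv :
    ContinuousOn (fun h : UnitaryGroup.«local» L (IsCMField.complexConj L) (n + n) (hermD L e dV hdV dW hdW) v =>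
        Matrix.reindex e.symm e.symm
          (((Matrix.reindex (e₂ (n := n)).symm (e₂ (n := n)).symm (Units.val (Subtype.val h))).toBlocks₂₂ -
              (Matrix.reindex (e₂ (n := n)).symm (e₂ (n := n)).symm (Units.val (Subtype.val h))).toBlocks₁₂)⁻¹ *
            ((Matrix.reindex (e₂ (n := n)).symm (e₂ (n := n)).symm (Units.val (Subtype.val h))).toBlocks₁₁ -
              (Matrix.reindex (e₂ (n := n)).symm (e₂ (n := n)).symm (Units.val (Subtype.val h))).toBlocks₂₁)))
      {h | IsUnit ((Matrix.reindex (e₂ (n := n)).symm (e₂ (n := n)).symm (Units.val (Subtype.val h))).toBlocks₂₂ -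
        (Matrix.reindex (e₂ (n := n)).symm (e₂ (n := n)).symm (Units.val (Subtype.val h))).toBlocks₁₂)} := by
  have hre : Continuous fun X : Matrix (Fin n) (Fin n) (UnitaryGroup.LocalRing L v) => Matrix.reindex e.symm e.symm X :=
    continuous_id.matrix_submatrix _ _
  exact hre.comp_continuousOn ((continuousOn_inv_mainOrbitBlock L e dV hdV dW hdW v).mul
    (continuous_subBlock L e dV hdV dW hdW v).continuousOn)

/-- **OPEN MAP**: `(p, x) ↦ p · ι_v(x, 1)` maps open sets of `P_{Δ,v} × G_v` to open sets of `H_v` — its inverse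
`h ↦ (h · ι_v(x(h), 1)⁻¹, x(h))`, `x(h)` the element of `G_v` with matrix `A°(h)`, is CONTINUOUS on the open `Ω_v`
(`Units.continuous_iff`: `A°(h)` by §0, `A°(h)⁻¹ = 𝕁_v⁻¹ ᵗ(c A°(h)) 𝕁_v` polynomially). [cite: GelbartPiatetskishapiroRallis1987, Part A §1–§2] -/
theorem isOpenMap_siegel_mul_iotaGGLoc (hJ : IsUnit (pairFormLoc L dV dW v).det) :
    IsOpenMap (fun px :
        {p : UnitaryGroup.«local» L (IsCMField.complexConj L) (n + n) (hermD L e dV hdV dW hdW) v //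
            IsSiegelM (n := n) (Units.val (Subtype.val p))} × localPairU L dV dW v =>
      (px.1.1 : UnitaryGroup.«local» L (IsCMField.complexConj L) (n + n) (hermD L e dV hdV dW hdW) v) *
        iotaGGLoc L e dV hdV dW hdW v (px.2, 1)) := by
  -- the `G`-coordinate on the open subtype `Ω_v`
  let Ω : Set (UnitaryGroup.«local» L (IsCMField.complexConj L) (n + n) (hermD L e dV hdV dW hdW) v) :=
    {h | IsUnit ((Matrix.reindex (e₂ (n := n)).symm (e₂ (n := n)).symm (Units.val (Subtype.val h))).toBlocks₂₂ -
        (Matrix.reindex (e₂ (n := n)).symm (e₂ (n := n)).symm (Units.val (Subtype.val h))).toBlocks₁₂)}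
  have hΩ : IsOpen Ω := isOpen_setOf_isUnit_mainOrbitBlock L e dV hdV dW hdW v
  let Amat : UnitaryGroup.«local» L (IsCMField.complexConj L) (n + n) (hermD L e dV hdV dW hdW) v →
      Matrix (Fin N × Fin M) (Fin N × Fin M) (UnitaryGroup.LocalRing L v) := fun h =>
    Matrix.reindex e.symm e.symm
      (((Matrix.reindex (e₂ (n := n)).symm (e₂ (n := n)).symm (Units.val (Subtype.val h))).toBlocks₂₂ -
          (Matrix.reindex (e₂ (n := n)).symm (e₂ (n := n)).symm (Units.val (Subtype.val h))).toBlocks₁₂)⁻¹ *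
        ((Matrix.reindex (e₂ (n := n)).symm (e₂ (n := n)).symm (Units.val (Subtype.val h))).toBlocks₁₁ -
          (Matrix.reindex (e₂ (n := n)).symm (e₂ (n := n)).symm (Units.val (Subtype.val h))).toBlocks₂₁))
  have hAmem : ∀ y : Ω, Matrix.nonsingInvUnit (Amat y.1) (isUnit_det_mainOrbitInv L e dV hdV dW hdW v hJ y.1 y.2) ∈
      localPairU L dV dW v := fun y =>
    unitary_mainOrbitInv L e dV hdV dW hdW v y.1 y.2
  let xG : Ω → localPairU L dV dW v := fun y =>
    ⟨Matrix.nonsingInvUnit (Amat y.1) (isUnit_det_mainOrbitInv L e dV hdV dW hdW v hJ y.1 y.2), hAmem y⟩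
  have hxG : ∀ y : Ω, Units.val (Subtype.val (xG y)) = Amat y.1 := fun y => rfl
  -- continuity of the `G`-coordinate
  have hAcont : Continuous fun y : Ω => Amat y.1 :=
    (continuousOn_mainOrbitInv L e dV hdV dW hdW v).comp_continuous continuous_subtype_val fun y => y.2
  have hinvcont : Continuous fun y : Ω => Units.val ((Matrix.nonsingInvUnit (Amat y.1)
      (isUnit_det_mainOrbitInv L e dV hdV dW hdW v hJ y.1 y.2))⁻¹) := by
    have hfun : (fun y : Ω => Units.val ((Matrix.nonsingInvUnit (Amat y.1)
        (isUnit_det_mainOrbitInv L e dV hdV dW hdW v hJ y.1 y.2))⁻¹)) =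
        fun y : Ω => (pairFormLoc L dV dW v)⁻¹ *
          ((Amat y.1).map (UnitaryGroup.conjLocal L (IsCMField.complexConj L) v))ᵀ * pairFormLoc L dV dW v := by
      funext y
      rw [Matrix.coe_units_inv]
      exact inv_eq_of_unitary _ hJ (unitary_mainOrbitInv L e dV hdV dW hdW v y.1 y.2)
    rw [hfun]
    exact (continuous_const.mul
      (hAcont.matrix_map (UnitaryGroup.continuous_conjLocal L (IsCMField.complexConj L) v)).matrix_transpose).mul
        continuous_const
  have hxGcont : Continuous xG :=
    Continuous.subtype_mk (Units.continuous_iff.2 ⟨hAcont, hinvcont⟩) _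
  -- the `P`-coordinate
  let pP : Ω → {p : UnitaryGroup.«local» L (IsCMField.complexConj L) (n + n) (hermD L e dV hdV dW hdW) v //
      IsSiegelM (n := n) (Units.val (Subtype.val p))} := fun y =>
    ⟨y.1 * (iotaGGLoc L e dV hdV dW hdW v (xG y, 1))⁻¹,
      isSiegelM_mul_iotaGGLoc_inv L e dV hdV dW hdW v hJ y.1 y.2 (xG y) (hxG y)⟩
  have hpPcont : Continuous pP :=
    Continuous.subtype_mk (continuous_subtype_val.mul
      ((continuous_iotaGGLoc L e dV hdV dW hdW v).comp (hxGcont.prodMk continuous_const)).inv) _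
  -- the inverse `q` and the two identities
  let q : Ω → {p : UnitaryGroup.«local» L (IsCMField.complexConj L) (n + n) (hermD L e dV hdV dW hdW) v //
      IsSiegelM (n := n) (Units.val (Subtype.val p))} × localPairU L dV dW v := fun y => (pP y, xG y)
  have hqcont : Continuous q := hpPcont.prodMk hxGcont
  have hfq : ∀ y : Ω, ((q y).1.1 : UnitaryGroup.«local» L (IsCMField.complexConj L) (n + n) (hermD L e dV hdV dW hdW) v) *
      iotaGGLoc L e dV hdV dW hdW v ((q y).2, 1) = y.1 := fun y =>
    mul_iotaGGLoc_inv_mul L e dV hdV dW hdW v y.1 (xG y)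
  -- open map: the image of an open `U` is `Subtype.val '' (q ⁻¹' U)`
  intro U hU
  have himage : (fun px :
        {p : UnitaryGroup.«local» L (IsCMField.complexConj L) (n + n) (hermD L e dV hdV dW hdW) v //
            IsSiegelM (n := n) (Units.val (Subtype.val p))} × localPairU L dV dW v =>
      (px.1.1 : UnitaryGroup.«local» L (IsCMField.complexConj L) (n + n) (hermD L e dV hdV dW hdW) v) *
        iotaGGLoc L e dV hdV dW hdW v (px.2, 1)) '' U = Subtype.val '' (q ⁻¹' U) := by
    ext z
    constructor
    · rintro ⟨px, hpx, rfl⟩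
      have hz : (px.1.1 : UnitaryGroup.«local» L (IsCMField.complexConj L) (n + n) (hermD L e dV hdV dW hdW) v) *
          iotaGGLoc L e dV hdV dW hdW v (px.2, 1) ∈ Ω :=
        isUnit_mainOrbitBlock_siegel_mul_iotaGGLoc L e dV hdV dW hdW v px.1.1 px.1.2 px.2
      refine ⟨⟨_, hz⟩, ?_, rfl⟩
      have hqy : q ⟨_, hz⟩ = px := injective_siegel_mul_iotaGGLoc L e dV hdV dW hdW v (hfq ⟨_, hz⟩)
      show q ⟨_, hz⟩ ∈ U
      rw [hqy]
      exact hpx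
    · rintro ⟨y, hy, rfl⟩
      exact ⟨q y, hy, hfq y⟩
  rw [himage]
  exact hΩ.isOpenMap_subtype_val _ (hU.preimage hqcont)

/-- **(B1) OPEN EMBEDDING.**  At a finite place `v` (with `det 𝕁_v` a unit, e.g. `dV i ≠ 0`, `dW j ≠ 0`, §5) the map
`P_{Δ,v} × G_v → H_v`, `(p, x) ↦ p · ι_v(x, 1)` is an open embedding of topological spaces.
[cite: GelbartPiatetskishapiroRallis1987, Part A §1–§2] [cite: Liu2021, §B.3 (B.5), Lem. B.11] [cite: Liu2011, §2C p. 863] -/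
theorem isOpenEmbedding_siegel_mul_iotaGGLoc (hJ : IsUnit (pairFormLoc L dV dW v).det) :
    IsOpenEmbedding (fun px :
        {p : UnitaryGroup.«local» L (IsCMField.complexConj L) (n + n) (hermD L e dV hdV dW hdW) v //
            IsSiegelM (n := n) (Units.val (Subtype.val p))} × localPairU L dV dW v =>
      (px.1.1 : UnitaryGroup.«local» L (IsCMField.complexConj L) (n + n) (hermD L e dV hdV dW hdW) v) *
        iotaGGLoc L e dV hdV dW hdW v (px.2, 1)) :=
  IsOpenEmbedding.of_continuous_injective_isOpenMap (continuous_siegel_mul_iotaGGLoc L e dV hdV dW hdW v)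
    (injective_siegel_mul_iotaGGLoc L e dV hdV dW hdW v) (isOpenMap_siegel_mul_iotaGGLoc L e dV hdV dW hdW v hJ)

/-- **(B1) RANGE = the main orbit `Ω_v = {IsUnit M(h)}`** (★ (A′) `exists_siegel_mul_iota_iff_isUnit_ring` in group form).
[cite: GelbartPiatetskishapiroRallis1987, Part A §1] [cite: Liu2021, §B.3 (B.5), Lem. B.11] -/
theorem range_siegel_mul_iotaGGLoc (hJ : IsUnit (pairFormLoc L dV dW v).det) :
    Set.range (fun px :
        {p : UnitaryGroup.«local» L (IsCMField.complexConj L) (n + n) (hermD L e dV hdV dW hdW) v //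
            IsSiegelM (n := n) (Units.val (Subtype.val p))} × localPairU L dV dW v =>
      (px.1.1 : UnitaryGroup.«local» L (IsCMField.complexConj L) (n + n) (hermD L e dV hdV dW hdW) v) *
        iotaGGLoc L e dV hdV dW hdW v (px.2, 1)) =
      {h | IsUnit ((Matrix.reindex (e₂ (n := n)).symm (e₂ (n := n)).symm (Units.val (Subtype.val h))).toBlocks₂₂ -
        (Matrix.reindex (e₂ (n := n)).symm (e₂ (n := n)).symm (Units.val (Subtype.val h))).toBlocks₁₂)} := by
  ext h
  constructor
  · rintro ⟨px, rfl⟩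
    exact isUnit_mainOrbitBlock_siegel_mul_iotaGGLoc L e dV hdV dW hdW v px.1.1 px.1.2 px.2
  · intro hM
    let x : localPairU L dV dW v :=
      ⟨Matrix.nonsingInvUnit _ (isUnit_det_mainOrbitInv L e dV hdV dW hdW v hJ h hM), unitary_mainOrbitInv L e dV hdV dW hdW v h hM⟩
    exact ⟨(⟨h * (iotaGGLoc L e dV hdV dW hdW v (x, 1))⁻¹, isSiegelM_mul_iotaGGLoc_inv L e dV hdV dW hdW v hJ h hM x rfl⟩, x),
      mul_iotaGGLoc_inv_mul L e dV hdV dW hdW v h x⟩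

/-- **the main orbit is exhausted**: every `h ∈ H_v` with `IsUnit M(h)` is `p · ι_v(x, 1)` with `p` Siegel, `x ∈ G_v`
(existence form of `range_siegel_mul_iotaGGLoc`, for consumers). [cite: Liu2021, Lem. B.11] [cite: GelbartPiatetskishapiroRallis1987, Part A §1] -/
theorem exists_siegel_mul_iotaGGLoc_eq (hJ : IsUnit (pairFormLoc L dV dW v).det)
    (h : UnitaryGroup.«local» L (IsCMField.complexConj L) (n + n) (hermD L e dV hdV dW hdW) v)
    (hM : IsUnit ((Matrix.reindex (e₂ (n := n)).symm (e₂ (n := n)).symm (Units.val (Subtype.val h))).toBlocks₂₂ -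
      (Matrix.reindex (e₂ (n := n)).symm (e₂ (n := n)).symm (Units.val (Subtype.val h))).toBlocks₁₂)) :
    ∃ (p : UnitaryGroup.«local» L (IsCMField.complexConj L) (n + n) (hermD L e dV hdV dW hdW) v) (x : localPairU L dV dW v),
      IsSiegelM (n := n) (Units.val (Subtype.val p)) ∧ p * iotaGGLoc L e dV hdV dW hdW v (x, 1) = h := by
  have hh : h ∈ Set.range (fun px :
        {p : UnitaryGroup.«local» L (IsCMField.complexConj L) (n + n) (hermD L e dV hdV dW hdW) v //
            IsSiegelM (n := n) (Units.val (Subtype.val p))} × localPairU L dV dW v =>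
      (px.1.1 : UnitaryGroup.«local» L (IsCMField.complexConj L) (n + n) (hermD L e dV hdV dW hdW) v) *
        iotaGGLoc L e dV hdV dW hdW v (px.2, 1)) := by
    rw [range_siegel_mul_iotaGGLoc L e dV hdV dW hdW v hJ]
    exact hM
  obtain ⟨px, hpx⟩ := hh
  exact ⟨px.1.1, px.2, px.1.2, hpx⟩

/-! ## §4 (D1) `P_{Δ,v} · ι_v(C, 1)` is closed for compact `C ⊆ G_v` -/

/-- `P_{Δ,v} = {IsSiegelM}` is CLOSED in `H_v` (a level set of `B(h)₁₁ + B(h)₁₂ = B(h)₂₁ + B(h)₂₂`). [cite: GelbartRogawski1991, §3.1 Prop. 3.1.1] -/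
theorem isClosed_setOf_isSiegelM :
    IsClosed {p : UnitaryGroup.«local» L (IsCMField.complexConj L) (n + n) (hermD L e dV hdV dW hdW) v |
      IsSiegelM (n := n) (Units.val (Subtype.val p))} := by
  unfold IsSiegelM
  exact isClosed_eq
    (((continuous_reindex_coe L e dV hdV dW hdW v).matrix_submatrix Sum.inl Sum.inl).add
      ((continuous_reindex_coe L e dV hdV dW hdW v).matrix_submatrix Sum.inl Sum.inr))
    (((continuous_reindex_coe L e dV hdV dW hdW v).matrix_submatrix Sum.inr Sum.inl).add
      ((continuous_reindex_coe L e dV hdV dW hdW v).matrix_submatrix Sum.inr Sum.inr))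

/-- **(D1) `P_{Δ,v} · ι_v(C, 1)` is CLOSED in `H_v` for every compact `C ⊆ G_v`** (closed set times compact set in a topological group;
needs neither `hJ` nor the open embedding). [cite: GelbartPiatetskishapiroRallis1987, Part A §1–§2] -/
theorem isClosed_image_siegel_mul_iotaGGLoc_of_isCompact {C : Set (localPairU L dV dW v)} (hC : IsCompact C) :
    IsClosed ((fun px :
        {p : UnitaryGroup.«local» L (IsCMField.complexConj L) (n + n) (hermD L e dV hdV dW hdW) v //
            IsSiegelM (n := n) (Units.val (Subtype.val p))} × localPairU L dV dW v =>
      (px.1.1 : UnitaryGroup.«local» L (IsCMField.complexConj L) (n + n) (hermD L e dV hdV dW hdW) v) *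
        iotaGGLoc L e dV hdV dW hdW v (px.2, 1)) '' (Set.univ ×ˢ C)) := by
  have hset : (fun px :
        {p : UnitaryGroup.«local» L (IsCMField.complexConj L) (n + n) (hermD L e dV hdV dW hdW) v //
            IsSiegelM (n := n) (Units.val (Subtype.val p))} × localPairU L dV dW v =>
      (px.1.1 : UnitaryGroup.«local» L (IsCMField.complexConj L) (n + n) (hermD L e dV hdV dW hdW) v) *
        iotaGGLoc L e dV hdV dW hdW v (px.2, 1)) '' (Set.univ ×ˢ C) =
      {p : UnitaryGroup.«local» L (IsCMField.complexConj L) (n + n) (hermD L e dV hdV dW hdW) v |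
          IsSiegelM (n := n) (Units.val (Subtype.val p))} *
        ((fun x : localPairU L dV dW v => iotaGGLoc L e dV hdV dW hdW v (x, 1)) '' C) := by
    ext z
    constructor
    · rintro ⟨⟨⟨p, hp⟩, x⟩, hmem, rfl⟩
      refine Set.mul_mem_mul ?_ ?_
      · exact hp
      · exact Set.mem_image_of_mem _ hmem.2
    · rintro ⟨p, hp, _, ⟨x, hx, rfl⟩, rfl⟩
      exact ⟨(⟨p, hp⟩, x), ⟨Set.mem_univ _, hx⟩, rfl⟩
  rw [hset]
  exact (isClosed_setOf_isSiegelM L e dV hdV dW hdW v).mul_right_of_isCompact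
    (hC.image ((continuous_iotaGGLoc L e dV hdV dW hdW v).comp (continuous_id.prodMk continuous_const)))

end Local

end Summit.HodgeConjecture.HodgeConjecture.Cruxes.HLiu418.K2LiuSiegelBigCellOpenEmbedding

end
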